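import Summits.ResolutionOfSingularities.ResolutionOfSingularities.Theses.VerticalModels
import Literature.AlgebraicGeometry.Resolution.BlowupsComposition
import Literature.AlgebraicGeometry.Resolution.BlowupsIntegral
import Literature.AlgebraicGeometry.Resolution.BlowupsProperProofs

/-!
# Birth skeleton (BC3) — crux `VerticalSplit` of route `VerticalModels`

Crux (item stmt-ResolutionOfSingularities-16200, route-ResolutionOfSingularities-VerticalModels):
`VerticalSplit : TameArcRegularization → WildCoreResolution → VerticalResolution`.

Line `birth`: the paper proof of the route docstring, cut into the three typing lemmas it names.
Given vertical data `(p, k, X, f, q)`, `TameArcRegularization` yields a fibre-cosupported blow-up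
`π : X' ⟶ X` with `X'` regular at tame-reachable points of `(X', π ≫ f, q)`; to feed
`(X', π ≫ f, q)` to `WildCoreResolution` one needs

* `stub_blowupStructure` — STRUCTURE TRANSPORT: `X'` is integral and `π ≫ f` is separated,
  locally of finite type and quasi-compact (blow-up of an integral Noetherian scheme along an
  ideal sheaf whose support misses a point: Stacks 02ND `IsBlowup.isIntegral`, Stacks 02NS
  `IsBlowup.isProper`, Mathlib composition instances, `LocallyOfFiniteType.isLocallyNoetherian`);
* `stub_blowupOffFibre` — OFF-FIBRE CONTROL: for a blow-up whose centre is cosupported in the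
  non-unit locus `V(t)` of a global section `t`, the unit locus of `π^* t` upstairs is inhabited
  if that of `t` is, and `X'` is regular wherever `π^* t` is a unit if `X` is regular wherever `t`
  is (stalk maps are local; `π` is an isomorphism off `Supp I ⊆ V(t)`: `IsBlowup.isIso_compl`;
  `IsRegularLocalRing.of_ringEquiv`);

and after `WildCoreResolution` has produced the second fibre-cosupported blow-up `π' : X'' ⟶ X'`
with `X''` regular,

* `stub_blowupCompFibre` — COMPOSITION: two blow-ups of a finite-type `k[T]`-scheme, the first
  cosupported in `V(t)`, the second in `V(π^* t)`, compose to ONE blow-up cosupported in `V(t)`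
  (Raynaud / Temkin 2008 Lemma 2.1.4 / Stacks 080B, in tree as
  `IsBlowup.exists_isBlowup_comp_supported` over a Noetherian base, with `V(π^* t) ⊆ π⁻¹ V(t)`
  because ring maps preserve units).

`VerticalSplit_of_stubs : <stub₁-sig> → <stub₂-sig> → <stub₃-sig> → (TameArcRegularization →
WildCoreResolution → VerticalResolution)` composes the three stub statements with the two engine
hypotheses (REAL proof, pure logic; the only definitional step is
`(π ≫ f).appTop = f.appTop ≫ π.appTop`, `rfl` in Mathlib, `Scheme.comp_appTop`), and the skeleton
theorem `VerticalSplit_of : VerticalSplit := VerticalSplit_of_stubs stub_blowupStructure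
stub_blowupOffFibre stub_blowupCompFibre` concludes the crux BY NAME. Sorries live only in the
three `stub_*` theorems (lean check: sorries = 3 = stubs, zero elsewhere).

Disproof used: none relevant (no `Disproof.lean` is registered on this crux, `ledger crux ls`
2026-08-17). Leans on (tree, all sorry-free): `IsBlowup.exists_isBlowup_comp_supported`
(BlowupsComposition.lean), `IsBlowup.isIntegral` (BlowupsIntegral.lean), `IsBlowup.isProper`
(BlowupsProperProofs.lean), `IsBlowup.isIso_compl` (Blowups.lean); Mathlib
`LocallyOfFiniteType.isLocallyNoetherian`, `IsRegularLocalRing.of_ringEquiv`,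
`isUnit_map_iff` / `IsLocalHom` for stalk maps.
-/

namespace Summit.ResolutionOfSingularities.ResolutionOfSingularities.Cruxes.VerticalSplit.Birth

open AlgebraicGeometry CategoryTheory
open Literature.AlgebraicGeometry.Resolution
open Summit.ResolutionOfSingularities.ResolutionOfSingularities.Theses.VerticalModels

/-- STUB 1 — STRUCTURE TRANSPORT along a blow-up of a finite-type `k[T]`-scheme: if `X` is
integral and `f : X ⟶ Spec k[T]` is separated, locally of finite type and quasi-compact, and
`π : X' ⟶ X` is a blow-up along an ideal sheaf `I` whose support misses some point (so `I ≠ ⊥`),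
then `X'` is integral and `π ≫ f` is again separated, locally of finite type and quasi-compact.
(Stacks 02ND: `IsBlowup.isIntegral`; Stacks 02NS: `IsBlowup.isProper` on the locally Noetherian
`X` — `LocallyOfFiniteType.isLocallyNoetherian f` over the Noetherian `Spec k[T]`; proper ⇒
separated + quasi-compact + locally of finite type; compositions by Mathlib instances.) -/
theorem stub_blowupStructure :
    ∀ (k : Type) [Field k] (X : Scheme.{0}) (f : X ⟶ Spec (.of (Polynomial k)))
      (I : X.IdealSheafData) (X' : Scheme.{0}) (π : X' ⟶ X),
      IsIntegral X → IsSeparated f → LocallyOfFiniteType f → QuasiCompact f →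
      IsBlowup π I → (∃ x : X, x ∉ (I.support : Set X)) →
      IsIntegral X' ∧ IsSeparated (π ≫ f) ∧ LocallyOfFiniteType (π ≫ f) ∧
        QuasiCompact (π ≫ f) := by
  sorry

/-- STUB 2 — OFF-FIBRE CONTROL: let `t ∈ Γ(X, 𝒪_X)` and let `π : X' ⟶ X` be a blow-up along an
ideal sheaf `I` cosupported in the non-unit locus `V(t) = {x | t_x ∉ 𝒪_{X,x}ˣ}`. Then
(i) if `t` is a unit at some point of `X`, then `π^* t` is a unit at some point of `X'`
(`π` is an isomorphism over `X ∖ Supp I ⊇ X ∖ V(t)`, `IsBlowup.isIso_compl`, and the germ of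
`π^* t` at a lift `x'` of `x` is the image of the germ of `t` under the stalk map); (ii) if `X` is
regular at every point where `t` is a unit, then `X'` is regular at every point `x'` where `π^* t`
is a unit (the stalk map `𝒪_{X,π x'} → 𝒪_{X',x'}` is local, so `t` is a unit at `π x'`, hence
`π x' ∉ Supp I`, hence the stalk map is an isomorphism and `IsRegularLocalRing.of_ringEquiv`
applies). -/
theorem stub_blowupOffFibre :
    ∀ (X : Scheme.{0}) (t : Γ(X, ⊤)) (I : X.IdealSheafData) (X' : Scheme.{0}) (π : X' ⟶ X),
      IsBlowup π I → (I.support : Set X) ⊆ {x | ¬ IsUnit (X.presheaf.germ ⊤ x trivial t)} →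
      ((∃ x : X, IsUnit (X.presheaf.germ ⊤ x trivial t)) →
          ∃ x' : X', IsUnit (X'.presheaf.germ ⊤ x' trivial (π.appTop t))) ∧
      ((∀ x : X, IsUnit (X.presheaf.germ ⊤ x trivial t) →
            IsRegularLocalRing (X.presheaf.stalk x)) →
          ∀ x' : X', IsUnit (X'.presheaf.germ ⊤ x' trivial (π.appTop t)) →
            IsRegularLocalRing (X'.presheaf.stalk x')) := by
  sorry

/-- STUB 3 — COMPOSITION OF FIBRE-COSUPPORTED BLOW-UPS (Raynaud; Temkin 2008, Lemma 2.1.4;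
Stacks 080B): let `X` be locally of finite type and quasi-compact over `Spec k[T]` (hence
Noetherian), `t ∈ Γ(X, 𝒪_X)`, `π : X' ⟶ X` a blow-up along `I` with `Supp I ⊆ V(t)` and
`π' : X'' ⟶ X'` a blow-up along `I'` with `Supp I' ⊆ V(π^* t)`. Then `π' ≫ π` is a blow-up of
`X` along some ideal sheaf `Q` with `Supp Q ⊆ V(t)`. (Tree:
`IsBlowup.exists_isBlowup_comp_supported` with `T := V(t)`, after `V(π^* t) ⊆ π⁻¹ V(t)` — ring
maps send units to units — and `IsNoetherian X` from
`LocallyOfFiniteType.isLocallyNoetherian` + quasi-compactness over the affine Noetherian base.) -/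
theorem stub_blowupCompFibre :
    ∀ (k : Type) [Field k] (X : Scheme.{0}) (f : X ⟶ Spec (.of (Polynomial k))) (t : Γ(X, ⊤))
      (I : X.IdealSheafData) (X' : Scheme.{0}) (π : X' ⟶ X)
      (I' : X'.IdealSheafData) (X'' : Scheme.{0}) (π' : X'' ⟶ X'),
      LocallyOfFiniteType f → QuasiCompact f →
      IsBlowup π I → (I.support : Set X) ⊆ {x | ¬ IsUnit (X.presheaf.germ ⊤ x trivial t)} →
      IsBlowup π' I' →
      (I'.support : Set X') ⊆ {x' | ¬ IsUnit (X'.presheaf.germ ⊤ x' trivial (π.appTop t))} →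
      ∃ Q : X.IdealSheafData, IsBlowup (π' ≫ π) Q ∧
        (Q.support : Set X) ⊆ {x | ¬ IsUnit (X.presheaf.germ ⊤ x trivial t)} := by
  sorry

/-- ENGINE COMPOSITION (hypothesis form, REAL proof, no sorry): the three stub STATEMENTS — taken
as hypotheses, exactly the signatures of `stub_blowupStructure`, `stub_blowupOffFibre`,
`stub_blowupCompFibre` — turn the two engine cruxes into the models statement: apply
`TameArcRegularization`, transport the vertical hypotheses to `(X', π ≫ f, q)` (stubs 1–2), apply
`WildCoreResolution`, compose the two fibre-cosupported blow-ups (stub 3). The conclusion is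
spelled as the UNFOLDED crux `TameArcRegularization → WildCoreResolution → VerticalResolution`
on purpose, so that exactly one theorem of this file — `VerticalSplit_of` below — concludes the
crux by name (the `#h21_check_skeleton` convention: the skeleton theorem takes no hypotheses other
than registered obligations and reaches the stubs BY NAME). -/
theorem VerticalSplit_of_stubs :
    (∀ (k : Type) [Field k] (X : Scheme.{0}) (f : X ⟶ Spec (.of (Polynomial k)))
      (I : X.IdealSheafData) (X' : Scheme.{0}) (π : X' ⟶ X),
      IsIntegral X → IsSeparated f → LocallyOfFiniteType f → QuasiCompact f →
      IsBlowup π I → (∃ x : X, x ∉ (I.support : Set X)) →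
      IsIntegral X' ∧ IsSeparated (π ≫ f) ∧ LocallyOfFiniteType (π ≫ f) ∧
        QuasiCompact (π ≫ f)) →
    (∀ (X : Scheme.{0}) (t : Γ(X, ⊤)) (I : X.IdealSheafData) (X' : Scheme.{0}) (π : X' ⟶ X),
      IsBlowup π I → (I.support : Set X) ⊆ {x | ¬ IsUnit (X.presheaf.germ ⊤ x trivial t)} →
      ((∃ x : X, IsUnit (X.presheaf.germ ⊤ x trivial t)) →
          ∃ x' : X', IsUnit (X'.presheaf.germ ⊤ x' trivial (π.appTop t))) ∧
      ((∀ x : X, IsUnit (X.presheaf.germ ⊤ x trivial t) →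
            IsRegularLocalRing (X.presheaf.stalk x)) →
          ∀ x' : X', IsUnit (X'.presheaf.germ ⊤ x' trivial (π.appTop t)) →
            IsRegularLocalRing (X'.presheaf.stalk x'))) →
    (∀ (k : Type) [Field k] (X : Scheme.{0}) (f : X ⟶ Spec (.of (Polynomial k))) (t : Γ(X, ⊤))
      (I : X.IdealSheafData) (X' : Scheme.{0}) (π : X' ⟶ X)
      (I' : X'.IdealSheafData) (X'' : Scheme.{0}) (π' : X'' ⟶ X'),
      LocallyOfFiniteType f → QuasiCompact f →
      IsBlowup π I → (I.support : Set X) ⊆ {x | ¬ IsUnit (X.presheaf.germ ⊤ x trivial t)} →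
      IsBlowup π' I' →
      (I'.support : Set X') ⊆ {x' | ¬ IsUnit (X'.presheaf.germ ⊤ x' trivial (π.appTop t))} →
      ∃ Q : X.IdealSheafData, IsBlowup (π' ≫ π) Q ∧
        (Q.support : Set X) ⊆ {x | ¬ IsUnit (X.presheaf.germ ⊤ x trivial t)}) →
    TameArcRegularization → WildCoreResolution → VerticalResolution := by
  intro h₁ h₂ h₃ hT hW p hp k _ _ X f q hq hint hsep hlft hqc hex hreg
  -- Step 1: the tame engine gives a fibre-cosupported blow-up, regular at tame-reachable points.
  obtain ⟨I, X', π, hπ, hIT, htame⟩ := hT p hp k X f q hq hint hsep hlft hqc hex hreg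
  -- the centre misses the (inhabited) unit locus of `t = f^* q`
  have hne : ∃ x : X, x ∉ (I.support : Set X) := by
    obtain ⟨x, hx⟩ := hex
    exact ⟨x, fun h => hIT h hx⟩
  -- Step 2: transport the vertical hypotheses to `(X', π ≫ f, q)`.
  obtain ⟨hint', hsep', hlft', hqc'⟩ := h₁ k X f I X' π hint hsep hlft hqc hπ hne
  obtain ⟨hex', hreg'⟩ :=
    h₂ X (f.appTop ((Scheme.ΓSpecIso (.of (Polynomial k))).inv q)) I X' π hπ hIT
  -- Step 3: the wild engine resolves the blown-up model
  -- (`(π ≫ f).appTop = f.appTop ≫ π.appTop` is `rfl`, `Scheme.comp_appTop`).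
  obtain ⟨I', X'', π', hπ', hI'T, hreg''⟩ :=
    hW p hp k X' (π ≫ f) q hq hint' hsep' hlft' hqc' (hex' hex) (hreg' hreg) htame
  -- Step 4: compose the two fibre-cosupported blow-ups into one.
  obtain ⟨Q, hQ, hQT⟩ :=
    h₃ k X f (f.appTop ((Scheme.ΓSpecIso (.of (Polynomial k))).inv q)) I X' π I' X'' π'
      hlft hqc hπ hIT hπ' hI'T
  exact ⟨Q, X'', π' ≫ π, hQ, hQT, hreg''⟩

/-- SKELETON THEOREM — the crux `VerticalSplit` BY NAME from the three declared stubs (the only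
sorries of the file live inside `stub_blowupStructure`, `stub_blowupOffFibre`,
`stub_blowupCompFibre`; this declaration and `VerticalSplit_of_stubs` are sorry-free). Once the
three stubs are proved this term closes item stmt-ResolutionOfSingularities-16200. -/
theorem VerticalSplit_of : VerticalSplit :=
  VerticalSplit_of_stubs stub_blowupStructure stub_blowupOffFibre stub_blowupCompFibre

end Summit.ResolutionOfSingularities.ResolutionOfSingularities.Cruxes.VerticalSplit.Birth
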